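import Summits.CriticalPhenomena.Ising3D.Control2DL19BoxW
import Summits.CriticalPhenomena.Ising3D.Control2DL19BoxX
import Mathlib.Tactic.NormNum
import HarnessLib

/-!
# Λ = 19 in the kernel: `0.99 < Δ_ε < 1.00005` at `Δ_σ = 1/8` under `A2D′`, no window — the reader-certified record, kernel-complete
(cell `pub-ising3x`, seat controls-1 gen 20; KERNEL PATH for the 2D γ-certificates, Λ ≤ 19 class-1 cover — CONTROL-ONLY)

HONEST FRAMING: lottery ticket; floor = tightest certified 3D Ising CFT bounds; no exact-solution
claim without a proof. CONTROL-ONLY (`d = 2`, `Δ_σ = 1/8`, axiom set `A2D′`); nothing about `d = 3`. This is the 2D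
control's reader-certified statement of record (`cover_v15.json`: `0.99 < Δ_ε < 1.00005`, Λ = 19 / E₀ = 48, readers A ∧ B)
now resting on the Lean kernel alone.

The RB-7 Λ = 19 / E₀ = 48 box certificate `j141725` (`[197/200, 99/100]`; truncation `Nd = 79` at spins 0, 2, 4, `71` at
6–14, `55` at 16, `47` at 18–46; `Control2DL19BoxX`) appended to `excludedOn_2d_cover0985` (`Control2DL19BoxW`: the Λ ≤ 15 box
cover + the Λ = 19 boxes V and W), with the Λ = 19 gap certificate `gapExcluded_2d_L19_gapC` (`Δ_ε < 20001/20000`) on top: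
* `excludedOn_2d_cover099 : ExcludedOn (1/8) 2 1 (Icc 0 (99/100))`;
* `twoSided_2d_kernel099 (w) : TwoSided (1/8) 2 1 w (99/100) (20001/20000)` for EVERY real `w` — under `A2D′` at
  `Δ_σ = 1/8`: `0.99 < Δ_ε < 1.00005` (2D Ising: `Δ_ε = 1`). No facts, standard axioms only.
-/

namespace Summit.CriticalPhenomena.Ising3D.Control2D

open Set
open Literature.MathematicalPhysics.QuantumFieldTheory.ConformalBootstrap3D

/-- **Kernel-complete cover of the `ε` locations `[0, 99/100]`** at `Δ_σ = 1/8` under `A2D′` (Λ = 19 box X appended to the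
`[0, 197/200]` cover). CONTROL-ONLY (d = 2). [cite: RattazziEtAl2008, §5.5] -/
theorem excludedOn_2d_cover099 : ExcludedOn (1 / 8 : ℝ) 2 1 (Icc (0 : ℝ) (99 / 100)) :=
  excludedOn_Icc_append excludedOn_2d_cover0985 excludedOn_2d_L19_boxX le_rfl

/-- **2D control, class 1, kernel-complete, Λ = 19 — for EVERY window parameter `w`**: under `A2D′` at `Δ_σ = 1/8`
the `ε` location satisfies `99/100 < Δ_ε < 20001/20000` — the reader-certified 2D statement of record, every obligation
of every certificate (Λ = 11 / 13 / 15 / 19 boxes, Λ = 19 gap) re-decided in the Lean kernel. CONTROL-ONLY (d = 2).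
[cite: RattazziEtAl2008, §5.5] -/
theorem twoSided_2d_kernel099 (w : ℝ) : TwoSided (1 / 8 : ℝ) 2 1 w (99 / 100) (20001 / 20000) :=
  twoSided_of_cover_zero excludedOn_2d_cover099 gapExcluded_2d_L19_gapC (by norm_num) w

end Summit.CriticalPhenomena.Ising3D.Control2D
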